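import Mathlib
import Summits.MatrixMultiplication.MatrixMultiplication.Theorems.LevelGradedCohnUmansLevelOneGL2DesignsTangencyParabolaLift

/-!
# Tangency sets with a unipotent symmetry are Paley lifts — wall-breaker axis
`Hermitian unital constructions` for the packing stub `stub_tangencySets` of the crux
`LevelOneGL2Designs` (stmt-MatrixMultiplication-14080, route `LevelGradedCohnUmans`), part I:
the normal forms

The stub asks for affine tangency sets of `AG(2,p)` — point sets `V ⊆ 𝔽_p²` every point of which
carries a line meeting `V` only there — of size `c·p^{3/2}` for unboundedly many primes `p`
(equivalently induced point–line matchings `IM(2,p) ≫ p^{3/2}`, see the sibling file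
`…StubTangencySetsHermitianReduction`).  Over a field of square order `q = r²` the affine Hermitian
unital `{Tr y = N x}` has `q^{3/2}` points and is an ORBIT GEOMETRY OF A `p`-GROUP: it is invariant
under the translations `y ↦ y + κ`, `κ ∈ ker Tr`, and under the Heisenberg shears
`(x, y) ↦ (x + a, y + Tr(ā x) + b)`.  Hunter–Pohoata–Verstraëte–Zhang (arXiv:2601.19879, §10) ask
whether a "unitary-like configuration" on the `p^{3/2}` scale can exist over a PRIME field.  This
file and its sequel answer the symmetric half of that question exactly: over `𝔽_p` a single
symmetry of order `p` already forces the Szőnyi parabola-pencil architecture, hence the Paley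
clique problem.

Affinities of `AG(2,p)` of order `p` are, up to affine conjugation (part II), translations or maps
`(x, y) ↦ (x + a, y + cx + b)` with `c ≠ 0`.  For an affine tangency set `V`:

* `card_le_of_translate_mem` — invariant under a non-zero translation ⇒ `|V| ≤ p` (a full line);
* `card_le_of_axialShear_mem` — invariant under the elation `(x, y) ↦ (x, y + cx + b)`, `c ≠ 0`
  ⇒ `|V| ≤ p + 1`;
* `exists_coclique_of_shear_mem` — invariant under the shear
  `(x, y) ↦ (x + a, y + 2κa·x + κa² + λa)`, `a, κ ≠ 0` ⇒ `V` is the pencil of parabolas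
  `y = κx² + λx + e`, `e ∈ E`, and `κ⁻¹E` is a Paley COCLIQUE (no two elements differ by a
  square), `|V| = p·|E|` (`parabola_mem_of_shear_mem` gives the orbit structure);
* `card_of_unipotentNormalForm_mem` — hence for the normal form `(x, y) ↦ (x + a, y + cx + b)`,
  `c ≠ 0`, `p` odd: `|V| ≤ p + 1` or `|V| = p·|I|` for a Paley coclique `I` (so `|V|² ≤ p³` by
  `ParabolaLift.card_coclique_sq_le`; part II).

So `p`-symmetric tangency sets reach order `p^{3/2}` only through Paley cocliques of order `√p`
(known for no prime; `ω(P_p) ≤ √(p/2) + 1`, Hanson–Petridis 2021, and `ω(P_p) = p^{o(1)}`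
expected): the residual of the Hermitian-symmetry axis is the residual of the parabola-lift axis
(`ParabolaLift.tangencySets_of_large_cocliques`).  All statements are elementary and fully proved;
no definitions, no named facts.
-/

set_option linter.dupNamespace false

noncomputable section

open Finset Matrix

namespace Summit.MatrixMultiplication.MatrixMultiplication.Theorems.LevelOneGL2Designs.UnipotentSymmetry

variable {p : ℕ} [Fact p.Prime]

omit [Fact p.Prime] in
/-- Two points of the plane with the same coordinates are equal. [elementary] -/
theorem vec2_ext {v w : Fin 2 → ZMod p} (h0 : v 0 = w 0) (h1 : v 1 = w 1) : v = w := by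
  funext i
  fin_cases i
  · exact h0
  · exact h1

/-- **Translation-invariant tangency sets are small.**  If an affine tangency set `V ⊆ AG(2,p)`
(every point carries a line meeting `V` only there) is invariant under a non-zero translation
`v ↦ v + t`, then `|V| ≤ p`: `V` is a union of full lines parallel to `t`, a tangent is never
parallel to `t`, and a line not parallel to `t` meets every line parallel to `t` — so `V` is a
single line. [elementary] -/
theorem card_le_of_translate_mem (V : Finset (Fin 2 → ZMod p))
    (hV : ∀ v ∈ V, ∃ u : Fin 2 → ZMod p, u ≠ 0 ∧ ∀ w ∈ V, u ⬝ᵥ w = u ⬝ᵥ v → w = v)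
    {t : Fin 2 → ZMod p} (ht : t ≠ 0) (hinv : ∀ v ∈ V, v + t ∈ V) : V.card ≤ p := by
  classical
  rcases V.eq_empty_or_nonempty with rfl | ⟨v, hv⟩
  · simp
  obtain ⟨u, -, hu⟩ := hV v hv
  have hiter : ∀ w ∈ V, ∀ k : ℕ, w + (k : ZMod p) • t ∈ V := by
    intro w hw k
    induction k with
    | zero => simpa using hw
    | succ k ih =>
      have h := hinv _ ih
      convert h using 1
      push_cast
      rw [add_smul, one_smul, add_assoc]
  have hall : ∀ w ∈ V, ∀ k : ZMod p, w + k • t ∈ V := by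
    intro w hw k
    obtain ⟨n, rfl⟩ := ZMod.natCast_zmod_surjective k
    exact hiter w hw n
  have hut : u ⬝ᵥ t ≠ 0 := by
    intro h0
    have h := hu (v + t) (hinv v hv) (by rw [dotProduct_add, h0, add_zero])
    exact ht (by simpa using h)
  have hline : ∀ w ∈ V, ∃ k : ZMod p, w = v + k • t := by
    intro w hw
    set k := (u ⬝ᵥ v - u ⬝ᵥ w) / (u ⬝ᵥ t) with hk
    have heq : u ⬝ᵥ (w + k • t) = u ⬝ᵥ v := by
      rw [dotProduct_add, dotProduct_smul, smul_eq_mul, hk, div_mul_cancel₀ _ hut]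
      ring
    have h := hu _ (hall w hw k) heq
    exact ⟨-k, by rw [← h, neg_smul, add_neg_cancel_right]⟩
  calc V.card ≤ ((univ : Finset (ZMod p)).image fun k => v + k • t).card := by
        apply card_le_card
        intro w hw
        obtain ⟨k, rfl⟩ := hline w hw
        exact mem_image_of_mem _ (mem_univ _)
    _ ≤ (univ : Finset (ZMod p)).card := card_image_le
    _ = p := by rw [card_univ, ZMod.card]

/-- **Tangency sets invariant under an axial shear are small.**  If an affine tangency set
`V ⊆ AG(2,p)` is invariant under `(x, y) ↦ (x, y + cx + b)` with `c ≠ 0` (an elation with affine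
axis `x = -b/c`), then `|V| ≤ p + 1`: off the axis `V` consists of full vertical lines, a tangent
at such a point is not vertical and meets every other vertical line, so there is at most one full
line, and then at most one point of `V` on the axis (its tangent must be the axis). [elementary] -/
theorem card_le_of_axialShear_mem (V : Finset (Fin 2 → ZMod p))
    (hV : ∀ v ∈ V, ∃ u : Fin 2 → ZMod p, u ≠ 0 ∧ ∀ w ∈ V, u ⬝ᵥ w = u ⬝ᵥ v → w = v)
    {b c : ZMod p} (hc : c ≠ 0) (hinv : ∀ v ∈ V, ![v 0, v 1 + (c * v 0 + b)] ∈ V) :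
    V.card ≤ p + 1 := by
  classical
  -- off the axis, whole columns
  have hiter : ∀ v ∈ V, ∀ k : ℕ, ![v 0, v 1 + k * (c * v 0 + b)] ∈ V := by
    intro v hv k
    induction k with
    | zero =>
      convert hv using 1
      exact vec2_ext (by simp) (by simp)
    | succ k ih =>
      have h := hinv _ ih
      convert h using 1
      refine vec2_ext (by simp) ?_
      simp only [cons_val_one, cons_val_zero, cons_val_fin_one]
      push_cast
      ring
  have hcol : ∀ v ∈ V, c * v 0 + b ≠ 0 → ∀ y : ZMod p, ![v 0, y] ∈ V := by
    intro v hv hmov y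
    obtain ⟨n, hn⟩ := ZMod.natCast_zmod_surjective ((y - v 1) / (c * v 0 + b))
    have h := hiter v hv n
    convert h using 1
    refine vec2_ext (by simp) ?_
    simp only [cons_val_one, cons_val_fin_one, hn, div_mul_cancel₀ _ hmov]
    ring
  -- a moving point has a non-vertical tangent, which then pins every other column
  have hmovx : ∀ v ∈ V, c * v 0 + b ≠ 0 → ∀ w ∈ V, w ≠ v → w 0 ≠ v 0 →
      ¬ (∀ y : ZMod p, ![w 0, y] ∈ V) := by
    intro v hv hmov w hw hne hx hwcol
    obtain ⟨u, hu0, hu⟩ := hV v hv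
    by_cases hu1 : u 1 = 0
    · -- vertical tangent: impossible, the column of `v` is full
      have hmem := hcol v hv hmov (v 1 + 1)
      have h := hu _ hmem (by
        rw [vec2_dotProduct, vec2_dotProduct, hu1]
        simp)
      have h1 := congr_fun h 1
      simp at h1
    · -- the tangent meets the (full) column of `w`
      set y := (u ⬝ᵥ v - u 0 * w 0) / u 1 with hy
      have hmem := hwcol y
      have h := hu _ hmem (by
        rw [vec2_dotProduct, cons_val_zero, cons_val_one, cons_val_fin_one, hy,
          mul_div_cancel₀ _ hu1]
        ring)
      exact hx (by simpa using congr_fun h 0)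
  -- split `V` into moving points and points of the axis
  set Vmov := V.filter fun v => c * v 0 + b ≠ 0 with hVmov
  set Vfix := V.filter fun v => ¬ (c * v 0 + b ≠ 0) with hVfix
  have hsplit : Vmov.card + Vfix.card = V.card := Finset.card_filter_add_card_filter_not _
  -- points of the axis all have first coordinate `-b/c`, so at most `p` of them
  have hfix_inj : Set.InjOn (fun v : Fin 2 → ZMod p => v 1) ↑Vfix := by
    intro v hv w hw h
    simp only [hVfix, coe_filter, Set.mem_setOf_eq, not_not] at hv hw
    refine vec2_ext ?_ h
    have h' : c * v 0 = c * w 0 := by linear_combination hv.2 - hw.2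
    exact mul_left_cancel₀ hc h'
  have hfix_le : Vfix.card ≤ p := by
    calc Vfix.card ≤ (univ : Finset (ZMod p)).card :=
          card_le_card_of_injOn _ (fun _ _ => mem_coe.mpr (mem_univ _)) hfix_inj
      _ = p := by rw [card_univ, ZMod.card]
  rcases Vmov.eq_empty_or_nonempty with hemp | ⟨v, hv⟩
  · rw [← hsplit, hemp, card_empty, zero_add]
    exact hfix_le.trans (Nat.le_succ p)
  · -- one moving point: all moving points share its column, and at most one axis point
    rw [hVmov, mem_filter] at hv
    have hmov_inj : Set.InjOn (fun w : Fin 2 → ZMod p => w 1) ↑Vmov := by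
      intro w hw w' hw' h
      simp only [hVmov, coe_filter, Set.mem_setOf_eq] at hw hw'
      refine vec2_ext ?_ h
      -- both columns are full, so both coincide with the column of `v`
      have hw0 : w 0 = v 0 := by
        by_contra hx
        by_cases hwv : w = v
        · exact hx (by rw [hwv])
        · exact hmovx v hv.1 hv.2 w hw.1 hwv hx (hcol w hw.1 hw.2)
      have hw0' : w' 0 = v 0 := by
        by_contra hx
        by_cases hwv : w' = v
        · exact hx (by rw [hwv])
        · exact hmovx v hv.1 hv.2 w' hw'.1 hwv hx (hcol w' hw'.1 hw'.2)
      rw [hw0, hw0']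
    have hmov_le : Vmov.card ≤ p := by
      calc Vmov.card ≤ (univ : Finset (ZMod p)).card :=
            card_le_card_of_injOn _ (fun _ _ => mem_coe.mpr (mem_univ _)) hmov_inj
        _ = p := by rw [card_univ, ZMod.card]
    have hfix1 : Vfix.card ≤ 1 := by
      rw [card_le_one]
      intro w hw w' hw'
      simp only [hVfix, mem_filter, not_not] at hw hw'
      by_contra hne
      obtain ⟨u, hu0, hu⟩ := hV w hw.1
      -- axis points have first coordinate different from `v 0`
      have hwx : w 0 ≠ v 0 := fun h => hv.2 (by rw [← h]; exact hw.2)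
      by_cases hu1 : u 1 = 0
      · -- vertical tangent at `w` contains `w'`
        have hx : w' 0 = w 0 := by
          have h' : c * w' 0 = c * w 0 := by linear_combination hw'.2 - hw.2
          exact mul_left_cancel₀ hc h'
        have h := hu w' hw'.1 (by simp [vec2_dotProduct, hu1, hx])
        exact hne h.symm
      · -- non-vertical tangent at `w` meets the full column of `v`
        set y := (u ⬝ᵥ w - u 0 * v 0) / u 1 with hy
        have hmem := hcol v hv.1 hv.2 y
        have h := hu _ hmem (by
          rw [vec2_dotProduct, cons_val_zero, cons_val_one, cons_val_fin_one, hy,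
            mul_div_cancel₀ _ hu1]
          ring)
        exact hwx (by simpa using (congr_fun h 0).symm)
    omega


/-- **Orbits of a shear are parabolas.**  If `V` is invariant under the affinity
`g(x, y) = (x + a, y + 2κa·x + (κa² + λa))` with `a ≠ 0`, then with every point `v` it contains the
whole parabola `y = κx² + λx + e` through `v` (`e = v₁ − κv₀² − λv₀` is constant along `g`-orbits and
`g` shifts the abscissa by `a`). [elementary] -/
theorem parabola_mem_of_shear_mem (V : Finset (Fin 2 → ZMod p)) {a κ μ : ZMod p} (ha : a ≠ 0)
    (hinv : ∀ v ∈ V, ![v 0 + a, v 1 + (2 * κ * a * v 0 + (κ * a ^ 2 + μ * a))] ∈ V) :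
    ∀ v ∈ V, ∀ x : ZMod p,
      ![x, κ * x ^ 2 + μ * x + (v 1 - κ * v 0 ^ 2 - μ * v 0)] ∈ V := by
  intro v hv x
  have hiter : ∀ k : ℕ, ![v 0 + k * a,
      κ * (v 0 + k * a) ^ 2 + μ * (v 0 + k * a) + (v 1 - κ * v 0 ^ 2 - μ * v 0)] ∈ V := by
    intro k
    induction k with
    | zero =>
      convert hv using 1
      exact vec2_ext (by simp) (by simp)
    | succ k ih =>
      have h := hinv _ ih
      convert h using 1
      refine vec2_ext ?_ ?_
      · simp only [cons_val_zero]
        push_cast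
        ring
      · simp only [cons_val_one, cons_val_zero, cons_val_fin_one]
        push_cast
        ring
  obtain ⟨n, hn⟩ := ZMod.natCast_zmod_surjective ((x - v 0) / a)
  have hx : v 0 + n * a = x := by rw [hn, div_mul_cancel₀ _ ha]; ring
  have h := hiter n
  rwa [hx] at h

/-- **Shear-invariant tangency sets are Paley parabola pencils.**  Let `V ⊆ AG(2,p)` be an affine
tangency set invariant under the shear `g(x, y) = (x + a, y + 2κa·x + (κa² + λa))` with `a ≠ 0`,
`κ ≠ 0` (the generic affinity of order `p`: unipotent linear part `≠ 1`, not an elation).  Then `V`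
is the union of the `p`-point parabolas `y = κx² + λx + e`, `e ∈ E`, and the tangency property
forces `(e − e')/κ` to be a NON-SQUARE for all `e ≠ e'` in `E` (a tangent line at a point of the
parabola `e` is vertical — impossible once `|E| ≥ 2` — or the parabola's own tangent, which meets
the parabola `e'` iff `(e − e')/κ` is a square).  Hence `|V| = p·|I|` for the Paley coclique
`I = κ⁻¹E`. [elementary] -/
theorem exists_coclique_of_shear_mem (V : Finset (Fin 2 → ZMod p))
    (hV : ∀ v ∈ V, ∃ u : Fin 2 → ZMod p, u ≠ 0 ∧ ∀ w ∈ V, u ⬝ᵥ w = u ⬝ᵥ v → w = v)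
    {a κ μ : ZMod p} (ha : a ≠ 0) (hκ : κ ≠ 0)
    (hinv : ∀ v ∈ V, ![v 0 + a, v 1 + (2 * κ * a * v 0 + (κ * a ^ 2 + μ * a))] ∈ V) :
    ∃ I : Finset (ZMod p), (∀ x ∈ I, ∀ y ∈ I, x ≠ y → ¬ IsSquare (x - y)) ∧
      V.card = p * I.card := by
  classical
  -- the orbit invariant and the fibre structure
  let φ : (Fin 2 → ZMod p) → ZMod p := fun v => v 1 - κ * v 0 ^ 2 - μ * v 0
  let P : ZMod p → ZMod p → (Fin 2 → ZMod p) := fun x e => ![x, κ * x ^ 2 + μ * x + e]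
  have hfib : ∀ v ∈ V, ∀ x : ZMod p, P x (φ v) ∈ V := parabola_mem_of_shear_mem V ha hinv
  have hrepr : ∀ v : Fin 2 → ZMod p, P (v 0) (φ v) = v := fun v =>
    vec2_ext (by simp [P]) (by simp [P, φ])
  set E := V.image φ with hE
  have hPE : ∀ x : ZMod p, ∀ e ∈ E, P x e ∈ V := by
    intro x e he
    obtain ⟨v, hv, rfl⟩ := mem_image.mp he
    exact hfib v hv x
  have hP0 : ∀ x e : ZMod p, P x e 0 = x := fun x e => by simp [P]
  have hP1 : ∀ x e : ZMod p, P x e 1 = κ * x ^ 2 + μ * x + e := fun x e => by simp [P]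
  have hPinj : ∀ x e x' e' : ZMod p, P x e = P x' e' → x = x' ∧ e = e' := by
    intro x e x' e' h
    have h0 := congr_fun h 0
    have h1 := congr_fun h 1
    rw [hP0, hP0] at h0
    rw [hP1, hP1, h0] at h1
    exact ⟨h0, by linear_combination h1⟩
  -- |V| = p · |E|
  have hcard : V.card = p * E.card := by
    have hVeq : V = (univ ×ˢ E).image fun xe => P xe.1 xe.2 := by
      ext v
      simp only [mem_image, mem_product, mem_univ, true_and, Prod.exists]
      constructor
      · intro hv
        exact ⟨v 0, φ v, mem_image_of_mem _ hv, hrepr v⟩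
      · rintro ⟨x, e, he, rfl⟩
        exact hPE x e he
    have hinj : Function.Injective fun xe : ZMod p × ZMod p => P xe.1 xe.2 := by
      rintro ⟨x, e⟩ ⟨x', e'⟩ h
      obtain ⟨rfl, rfl⟩ := hPinj x e x' e' h
      rfl
    rw [hVeq, card_image_of_injective _ hinj, card_product, card_univ, ZMod.card]
  -- the tangency property makes `κ⁻¹ E` a Paley coclique
  have hco : ∀ e₀ ∈ E, ∀ e ∈ E, e₀ ≠ e → ¬ IsSquare ((e₀ - e) / κ) := by
    intro e₀ he₀ e he hne hsq
    obtain ⟨u, hu0, hu⟩ := hV (P 0 e₀) (hPE 0 e₀ he₀)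
    by_cases hu1 : u 1 = 0
    · -- vertical tangent: it contains the point of the parabola `e` above `0`
      have h := hu (P 0 e) (hPE 0 e he) (by
        rw [vec2_dotProduct, vec2_dotProduct, hu1, hP0, hP0]
        ring)
      exact hne ((hPinj _ _ _ _ h).2.symm)
    · by_cases hdir : u 0 = -μ * u 1
      · -- the tangent of the parabola `e₀`: it meets the parabola `e` above `r`, `κ r² = e₀ - e`
        obtain ⟨r, hr⟩ := hsq
        have h := hu (P r e) (hPE r e he) (by
          rw [vec2_dotProduct, vec2_dotProduct, hP0, hP0, hP1, hP1, hdir]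
          have hr' : e₀ - e = κ * (r * r) := by rw [← hr, mul_div_cancel₀ _ hκ]
          linear_combination (-u 1) * hr')
        exact hne ((hPinj _ _ _ _ h).2.symm)
      · -- any other non-vertical line through `P 0 e₀` meets the parabola `e₀` again
        set z := (-(u 0) / u 1 - μ) / κ with hz
        have hz0 : z ≠ 0 := by
          rw [hz]
          refine div_ne_zero ?_ hκ
          intro h0
          apply hdir
          field_simp at h0
          linear_combination -h0
        have h := hu (P z e₀) (hPE z e₀ he₀) (by
          rw [vec2_dotProduct, vec2_dotProduct, hP0, hP0, hP1, hP1]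
          have hκz : κ * z * u 1 = -(u 0) - μ * u 1 := by
            rw [hz]
            field_simp
          linear_combination z * hκz)
        exact hz0 (hPinj _ _ _ _ h).1
  refine ⟨E.image fun e => e / κ, ?_, ?_⟩
  · simp only [mem_image]
    rintro _ ⟨e₀, he₀, rfl⟩ _ ⟨e, he, rfl⟩ hne'
    have hne : e₀ ≠ e := fun h => hne' (by rw [h])
    rw [← sub_div]
    exact hco e₀ he₀ e he hne
  · have hinj : Function.Injective fun e : ZMod p => e / κ := fun x y h => by
      simpa [div_left_inj' hκ] using h
    rw [hcard, card_image_of_injective _ hinj]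


/-- **Unipotent normal form ⇒ Paley or small.**  Let `p` be an odd prime and let the affine tangency
set `V ⊆ AG(2,p)` be invariant under `g(x, y) = (x + a, y + cx + b)` with `c ≠ 0` — the normal form,
up to affine conjugation, of every affinity of order `p` whose linear part is not the identity.  Then
either `|V| ≤ p + 1` (the elation case `a = 0`, `card_le_of_axialShear_mem`) or `|V| = p·|I|` for a
Paley coclique `I ⊆ 𝔽_p` (the shear case `a ≠ 0`, `exists_coclique_of_shear_mem` with `κ = c/2a`).
[elementary] -/
theorem card_of_unipotentNormalForm_mem (V : Finset (Fin 2 → ZMod p))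
    (hV : ∀ v ∈ V, ∃ u : Fin 2 → ZMod p, u ≠ 0 ∧ ∀ w ∈ V, u ⬝ᵥ w = u ⬝ᵥ v → w = v)
    (hp2 : p ≠ 2) {a b c : ZMod p} (hc : c ≠ 0)
    (hinv : ∀ v ∈ V, ![v 0 + a, v 1 + (c * v 0 + b)] ∈ V) :
    V.card ≤ p + 1 ∨ ∃ I : Finset (ZMod p), (∀ x ∈ I, ∀ y ∈ I, x ≠ y → ¬ IsSquare (x - y)) ∧
      V.card = p * I.card := by
  by_cases ha : a = 0
  · subst ha
    left
    refine card_le_of_axialShear_mem V hV (b := b) hc fun v hv => ?_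
    have h := hinv v hv
    rwa [add_zero] at h
  · right
    have h2 : (2 : ZMod p) ≠ 0 := Ring.two_ne_zero (by rw [ZMod.ringChar_zmod_n]; exact hp2)
    set κ := c / (2 * a) with hκ
    set μ := (b - κ * a ^ 2) / a with hμ
    have hκ0 : κ ≠ 0 := div_ne_zero hc (mul_ne_zero h2 ha)
    have key : ∀ x : ZMod p, 2 * κ * a * x + (κ * a ^ 2 + μ * a) = c * x + b := by
      intro x
      rw [hμ, hκ]
      field_simp
      ring
    refine exists_coclique_of_shear_mem V hV ha hκ0 (μ := μ) fun v hv => ?_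
    rw [key]
    exact hinv v hv

end Summit.MatrixMultiplication.MatrixMultiplication.Theorems.LevelOneGL2Designs.UnipotentSymmetry

end
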